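import Mathlib.Analysis.SpecificLimits.Basic
import HarnessLib

/-!
# K1L_D (stmt-AnomalousDissipation-27980), stub `stub_oneLevelL_IW`: the CONFINEMENT PROFILE INDUCTION (finding F-lead-6)
# (helper; `--supports … --as helper`; real-variable skeleton of S3′(e))

Spectral confinement of the true solution below the junk line (lead memo L4 / p4 memo L4b / F-lead-6) is, once the cell-side inputs are in place,
a two-index induction on the PROFILE `P k i` = slow energy of the window-`k` state above the scale `L_i = L_c·r^i` (`r = 1 + 3ε_w + δ_min` = the most a
frame reset can move Fourier support for free): the trimmed datum is band-limited at `L_c` (`P 0 (i+1) ≤ β`), nothing exceeds the total energy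
(`P k 0 ≤ E`), and one window + one reset turn energy above `L_i` into energy above `L_{i+1}` with a factor `α = e^{−2D_w} + Cη²` (per-window decay plus
tracking floor, (B_G)) up to an absolute tail `β` (reset spread S3e′, hop tails).  Conclusion: `P k i ≤ α^i·E + β·Σ_{j<i} α^j` for all `k`, i.e.
`≤ α^i E + 2β` when `α ≤ 1/2` — super-small at the junk line since `i ≈ ln 2/(4ε_w)` is astronomically large.  Pure real induction; the analysis is in
the inputs.  Infrastructure for rung F-D1.A0; NOT a proof of the crux or of anomalous dissipation.
-/

set_option linter.dupNamespace false

namespace Summit.AnomalousDissipation.AnomalousDissipation.Theorems.SolenoidalFractalHomogenisation.LagrangianStep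

open Finset

/-- **Profile induction.**  If `P k 0 ≤ E` for all windows `k`, `P 0 (i+1) ≤ β` for all scales (band-limited datum), and each window step satisfies
`P (k+1) (i+1) ≤ α·P k i + β` (`α, β, E ≥ 0`), then `P k i ≤ α^i·E + β·Σ_{j<i} α^j` for all `k, i`. -/
theorem profile_le (P : ℕ → ℕ → ℝ) {E α β : ℝ} (hE : 0 ≤ E) (hα : 0 ≤ α) (hβ : 0 ≤ β)
    (h0 : ∀ k, P k 0 ≤ E) (hinit : ∀ i, P 0 (i + 1) ≤ β) (hstep : ∀ k i, P (k + 1) (i + 1) ≤ α * P k i + β) :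
    ∀ k i, P k i ≤ α ^ i * E + β * ∑ j ∈ range i, α ^ j := by
  intro k i
  induction i generalizing k with
  | zero => simpa using h0 k
  | succ i ih =>
    cases k with
    | zero =>
      have h1 : (1 : ℝ) ≤ ∑ j ∈ range (i + 1), α ^ j := by
        rw [Finset.sum_range_succ']
        simp only [pow_zero]
        have : 0 ≤ ∑ j ∈ range i, α ^ (j + 1) := Finset.sum_nonneg fun j _ => pow_nonneg hα _
        linarith
      have h2 : 0 ≤ α ^ (i + 1) * E := mul_nonneg (pow_nonneg hα _) hE
      calc P 0 (i + 1) ≤ β := hinit i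
        _ = β * 1 := (mul_one β).symm
        _ ≤ β * ∑ j ∈ range (i + 1), α ^ j := mul_le_mul_of_nonneg_left h1 hβ
        _ ≤ α ^ (i + 1) * E + β * ∑ j ∈ range (i + 1), α ^ j := le_add_of_nonneg_left h2
    | succ k =>
      have hk := ih k
      calc P (k + 1) (i + 1) ≤ α * P k i + β := hstep k i
        _ ≤ α * (α ^ i * E + β * ∑ j ∈ range i, α ^ j) + β := by
            have := mul_le_mul_of_nonneg_left hk hα; linarith
        _ = α ^ (i + 1) * E + β * ∑ j ∈ range (i + 1), α ^ j := by
            rw [Finset.sum_range_succ', pow_zero]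
            have : α * (β * ∑ j ∈ range i, α ^ j) = β * ∑ j ∈ range i, α ^ (j + 1) := by
              rw [Finset.mul_sum, Finset.mul_sum, Finset.mul_sum]
              exact Finset.sum_congr rfl fun j _ => by ring
            rw [mul_add, this]; ring

/-- **Profile induction, contracting case**: with `α ≤ 1/2` the geometric sum is `≤ 2`, so `P k i ≤ α^i·E + 2β` for all `k, i`. -/
theorem profile_le_of_le_half (P : ℕ → ℕ → ℝ) {E α β : ℝ} (hE : 0 ≤ E) (hα : 0 ≤ α) (hα2 : α ≤ 1 / 2) (hβ : 0 ≤ β)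
    (h0 : ∀ k, P k 0 ≤ E) (hinit : ∀ i, P 0 (i + 1) ≤ β) (hstep : ∀ k i, P (k + 1) (i + 1) ≤ α * P k i + β) (k i : ℕ) :
    P k i ≤ α ^ i * E + 2 * β := by
  have h := profile_le P hE hα hβ h0 hinit hstep k i
  have hgeom : ∑ j ∈ range i, α ^ j ≤ 2 := by
    have hlt : α < 1 := by linarith
    calc ∑ j ∈ range i, α ^ j ≤ ∑' j, α ^ j :=
          (summable_geometric_of_lt_one hα hlt).sum_le_tsum (range i) (fun j _ => pow_nonneg hα _)
      _ = (1 - α)⁻¹ := tsum_geometric_of_lt_one hα hlt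
      _ ≤ 2 := by
          rw [inv_le_comm₀ (by linarith) (by norm_num)]
          linarith
  have := mul_le_mul_of_nonneg_left hgeom hβ
  linarith

/-- **Exponential smallness of the top of the profile**: if moreover `α ≤ 1/2` then `α^i ≤ (1/2)^i`, so at the top scale `i = I` the profile is
`≤ E/2^I + 2β`. -/
theorem profile_top_le (P : ℕ → ℕ → ℝ) {E α β : ℝ} (hE : 0 ≤ E) (hα : 0 ≤ α) (hα2 : α ≤ 1 / 2) (hβ : 0 ≤ β)
    (h0 : ∀ k, P k 0 ≤ E) (hinit : ∀ i, P 0 (i + 1) ≤ β) (hstep : ∀ k i, P (k + 1) (i + 1) ≤ α * P k i + β) (k I : ℕ) :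
    P k I ≤ E / 2 ^ I + 2 * β := by
  have h := profile_le_of_le_half P hE hα hα2 hβ h0 hinit hstep k I
  have hpow : α ^ I ≤ (1 / 2) ^ I := pow_le_pow_left₀ hα hα2 I
  have : α ^ I * E ≤ E / 2 ^ I := by
    calc α ^ I * E ≤ (1 / 2) ^ I * E := mul_le_mul_of_nonneg_right hpow hE
      _ = E / 2 ^ I := by rw [one_div, inv_pow]; ring
  linarith

end Summit.AnomalousDissipation.AnomalousDissipation.Theorems.SolenoidalFractalHomogenisation.LagrangianStep
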